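import Summits.QuantumFields.YangMills.Theses.BalabanMarkovExport
import Literature.MathematicalPhysics.QuantumFieldTheory.Balaban1983to89.B3Taylor310LocalRemainder
import Literature.MathematicalPhysics.QuantumFieldTheory.Balaban1983to89.T4AveragingDisintegration
import HarnessLib

/-!
# Toolkit for the Markov export glue (route `BalabanMarkovExport`, item stmt-QuantumFields-27293)

Elementary lemmas used by `Theorems/BalabanMarkovExportMarkovExportGlue.lean`
(`ShellLaw → ConstrainedMarkov → CondResponse → BalabanFamilyExport.FamilyCeilings`):

* §1 BLOCK ARITHMETIC on a cycle of `n = b·N` sites cut into `N` blocks of `b` consecutive sites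
  (block index `s.val / b` read in `ZMod N`): the cyclic distance of two sites and `b` times the cyclic
  distance of their blocks differ by at most `b − 1` in either direction
  (`natAbs_valMinAbs_sub_le_block`, `block_natAbs_valMinAbs_sub_le`), via integer representatives and the
  minimality of `ZMod.valMinAbs`;
* §2 consequences for Bałaban's `ℓ¹` block distance `Site.tdist` of the coordinatewise block map
  (the `cb`/`cs` of the route's statements): `34·b + 4`-separated sites have blocks at distance `≥ 34`
  (`le_tdist_blocks_of_sep`), a unit lattice step moves the block by at most `1` (`tdist_blocks_add_single_le_one`);
* §3 CYLINDER MEASURABILITY: the single-plane plaquette field `plane q x ∘ torusLift M` is measurable with respect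
  to the σ-algebra of the links in any edge set containing the four edges of the plaquette
  (`measurable_comap_restrict_plane`), restriction σ-algebras are monotone in the edge set
  (`comap_restrict_mono`), and — LUSIN SEPARATION — on a standard Borel space a Borel function of the form `g ∘ Q`
  (`Q` measurable into a countably separated space) is measurable for the σ-algebra GENERATED BY `Q`
  (`measurable_comap_of_measurable_comp`): this is how the AMBIENT measurability of `gᵢ ∘ Q_k` delivered by
  `CondResponse` meets the `σ(Q_k)`-measurability that `ShellLaw` asks of its versions (its `Measurable (g ∘ Q)`
  hypotheses are elaborated under the local instance `mQ`);
* §4 two bookkeeping lemmas (bounded measurable ⇒ integrable; `|∏_{i∈S} fᵢ| ≤ K^{#S}`).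

Pure lattice bookkeeping; nothing about Yang–Mills is proved here (YM mass gap NOT proved).
-/

set_option autoImplicit false

namespace Summit.QuantumFields.YangMills.Theorems.BalabanMarkovExport.Toolkit

open MeasureTheory
open Literature.MathematicalPhysics.QuantumFieldTheory
open Literature.MathematicalPhysics.QuantumFieldTheory.Balaban1983to89
open Literature.MathematicalPhysics.QuantumLattice (LGConfig torusLift)
open Summit.QuantumFields.YangMills.Cruxes.OSLegsFromFemtoAndGap.DlrCollarTransfer (plane)

/-! ## §1 Block arithmetic on a cycle -/

/-- Minimality of the least-absolute-value residue: the cyclic size of `a : ZMod n` is at most the size of any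
integer representative of `a`. -/
theorem natAbs_valMinAbs_le_natAbs {n : ℕ} [NeZero n] (a : ZMod n) (y : ℤ) (h : (y : ZMod n) = a) :
    a.valMinAbs.natAbs ≤ y.natAbs :=
  ZMod.natAbs_min_of_le_div_two n a.valMinAbs y (by rw [ZMod.coe_valMinAbs, h]) (ZMod.natAbs_valMinAbs_le a)

/-- UP: on a cycle of `n = b·N` sites, the cyclic distance of two sites is at most `b` times the cyclic distance
of their blocks (`s.val / b` in `ZMod N`) plus `b − 1`. -/
theorem natAbs_valMinAbs_sub_le_block {b N n : ℕ} [NeZero n] [NeZero N] (hn : n = b * N) (hb : 0 < b)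
    (s t : ZMod n) :
    (s - t).valMinAbs.natAbs ≤
      b * (((s.val / b : ℕ) : ZMod N) - ((t.val / b : ℕ) : ZMod N)).valMinAbs.natAbs + (b - 1) := by
  set qs := s.val / b with hqs
  set qt := t.val / b with hqt
  set rs := s.val % b with hrs
  set rt := t.val % b with hrt
  have hs : b * qs + rs = s.val := Nat.div_add_mod _ _
  have ht : b * qt + rt = t.val := Nat.div_add_mod _ _
  have hrs' : rs < b := Nat.mod_lt _ hb
  have hrt' : rt < b := Nat.mod_lt _ hb
  set δ : ℤ := (((qs : ℕ) : ZMod N) - ((qt : ℕ) : ZMod N)).valMinAbs with hδ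
  have hδc : ((δ : ℤ) : ZMod N) = ((qs : ℕ) : ZMod N) - ((qt : ℕ) : ZMod N) := ZMod.coe_valMinAbs _
  have hdvd : (N : ℤ) ∣ ((qs : ℤ) - qt - δ) := by
    rw [← ZMod.intCast_zmod_eq_zero_iff_dvd]
    push_cast
    rw [hδc]; ring
  obtain ⟨j, hj⟩ := hdvd
  set y : ℤ := (b : ℤ) * δ + ((rs : ℤ) - rt) with hy
  have hyc : ((y : ℤ) : ZMod n) = s - t := by
    have es : (s : ZMod n) = ((s.val : ℕ) : ZMod n) := (ZMod.natCast_zmod_val s).symm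
    have et : (t : ZMod n) = ((t.val : ℕ) : ZMod n) := (ZMod.natCast_zmod_val t).symm
    rw [es, et, ← hs, ← ht]
    have h1 : ((b * qs + rs : ℕ) : ZMod n) - ((b * qt + rt : ℕ) : ZMod n) =
        (((b : ℤ) * ((qs : ℤ) - qt) + ((rs : ℤ) - rt) : ℤ) : ZMod n) := by
      push_cast; ring
    rw [h1]
    have h2 : (b : ℤ) * ((qs : ℤ) - qt) + ((rs : ℤ) - rt) = y + (n : ℤ) * j := by
      have : (qs : ℤ) - qt = δ + N * j := by linarith
      rw [this, hy, hn]; push_cast; ring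
    rw [h2]
    push_cast
    simp
  have h3 := natAbs_valMinAbs_le_natAbs (s - t) y hyc
  have h4 : y.natAbs ≤ b * δ.natAbs + (b - 1) := by
    have h5 : ((rs : ℤ) - rt).natAbs ≤ b - 1 := by omega
    calc y.natAbs ≤ ((b : ℤ) * δ).natAbs + ((rs : ℤ) - rt).natAbs := Int.natAbs_add_le _ _
      _ ≤ b * δ.natAbs + (b - 1) := by
          rw [Int.natAbs_mul, Int.natAbs_natCast]; exact Nat.add_le_add_left h5 _
  exact h3.trans h4

/-- DOWN: on a cycle of `n = b·N` sites, `b` times the cyclic distance of the blocks of two sites is at most the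
cyclic distance of the sites plus `b − 1`. -/
theorem block_natAbs_valMinAbs_sub_le {b N n : ℕ} [NeZero n] [NeZero N] (hn : n = b * N) (hb : 0 < b)
    (s t : ZMod n) :
    b * (((s.val / b : ℕ) : ZMod N) - ((t.val / b : ℕ) : ZMod N)).valMinAbs.natAbs ≤
      (s - t).valMinAbs.natAbs + (b - 1) := by
  set qs := s.val / b with hqs
  set qt := t.val / b with hqt
  set rs := s.val % b with hrs
  set rt := t.val % b with hrt
  have hs : b * qs + rs = s.val := Nat.div_add_mod _ _
  have ht : b * qt + rt = t.val := Nat.div_add_mod _ _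
  have hrs' : rs < b := Nat.mod_lt _ hb
  have hrt' : rt < b := Nat.mod_lt _ hb
  set y : ℤ := (s - t).valMinAbs with hy
  have hyc : ((y : ℤ) : ZMod n) = s - t := ZMod.coe_valMinAbs _
  have hdvd : (n : ℤ) ∣ ((s.val : ℤ) - t.val - y) := by
    rw [← ZMod.intCast_zmod_eq_zero_iff_dvd]
    push_cast
    rw [ZMod.natCast_zmod_val, ZMod.natCast_zmod_val, hyc]; ring
  obtain ⟨j, hj⟩ := hdvd
  set δ' : ℤ := (qs : ℤ) - qt - N * j with hδ'
  have hbδ : (b : ℤ) * δ' = y - ((rs : ℤ) - rt) := by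
    have e1 : ((s.val : ℕ) : ℤ) = b * qs + rs := by rw [← hs]; push_cast; ring
    have e2 : ((t.val : ℕ) : ℤ) = b * qt + rt := by rw [← ht]; push_cast; ring
    rw [e1, e2, hn] at hj
    push_cast at hj
    rw [hδ']
    linarith
  have hδ'c : ((δ' : ℤ) : ZMod N) = ((qs : ℕ) : ZMod N) - ((qt : ℕ) : ZMod N) := by
    rw [hδ']; push_cast; simp
  have h3 := natAbs_valMinAbs_le_natAbs _ δ' hδ'c
  have h4 : b * δ'.natAbs ≤ y.natAbs + (b - 1) := by
    have h5 : ((b : ℤ) * δ').natAbs = b * δ'.natAbs := by rw [Int.natAbs_mul, Int.natAbs_natCast]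
    rw [← h5, hbδ]
    have h6 : ((rs : ℤ) - rt).natAbs ≤ b - 1 := by omega
    calc (y - ((rs : ℤ) - rt)).natAbs ≤ y.natAbs + ((rs : ℤ) - rt).natAbs := Int.natAbs_sub_le _ _
      _ ≤ y.natAbs + (b - 1) := Nat.add_le_add_left h6 _
  exact (Nat.mul_le_mul_left b h3).trans h4

/-! ## §2 The coordinatewise block map and Bałaban's `ℓ¹` block distance -/

section Blocks

variable {P : Params} {k n : ℕ} [NeZero n] [NeZero (P.sitesPerDir k)]

/-- SEPARATED SITES HAVE FAR BLOCKS: if two sites of the `n = b·N`-torus (`N = P.sitesPerDir k` blocks of side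
`b` per direction) are `34·b + 4`-separated cyclically in some coordinate `κ`, their blocks are at `ℓ¹` torus
distance `≥ 34` on `T^{(k)}`. -/
theorem le_tdist_blocks_of_sep {b : ℕ} (hn : n = b * P.sitesPerDir k) (hb : 0 < b)
    (s t : Fin P.d → ZMod n) (κ : Fin P.d) (hsep : 34 * b + 4 ≤ ((s κ - t κ).valMinAbs).natAbs) :
    34 ≤ Site.tdist (fun ν => ((((s ν).val / b : ℕ)) : ZMod (P.sitesPerDir k)) : Site P k)
      (fun ν => ((((t ν).val / b : ℕ)) : ZMod (P.sitesPerDir k))) := by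
  rw [B3Taylor310LocalRemainder.tdist_eq_sum_natAbs]
  have h1 := natAbs_valMinAbs_sub_le_block (N := P.sitesPerDir k) hn hb (s κ) (t κ)
  have h2 : 34 ≤ ((((s κ).val / b : ℕ) : ZMod (P.sitesPerDir k)) -
      (((t κ).val / b : ℕ) : ZMod (P.sitesPerDir k))).valMinAbs.natAbs := by
    by_contra h
    push Not at h
    have h3 : b * ((((s κ).val / b : ℕ) : ZMod (P.sitesPerDir k)) -
        (((t κ).val / b : ℕ) : ZMod (P.sitesPerDir k))).valMinAbs.natAbs ≤ b * 33 :=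
      Nat.mul_le_mul_left b (by omega)
    omega
  exact h2.trans (Finset.single_le_sum (f := fun μ => ((((((s μ).val / b : ℕ)) : ZMod (P.sitesPerDir k)) -
    (((t μ).val / b : ℕ) : ZMod (P.sitesPerDir k))).valMinAbs).natAbs) (fun μ _ => Nat.zero_le _)
    (Finset.mem_univ κ))

/-- A UNIT LATTICE STEP MOVES THE BLOCK BY AT MOST ONE: the blocks of `s` and `s + e_i` are at `ℓ¹` torus
distance `≤ 1`. -/
theorem tdist_blocks_add_single_le_one {b : ℕ} (hn : n = b * P.sitesPerDir k) (hb : 0 < b)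
    (s : Fin P.d → ZMod n) (i : Fin P.d) :
    Site.tdist (fun ν => (((((s + Pi.single i (1 : ZMod n) : Fin P.d → ZMod n) ν).val / b : ℕ)) :
        ZMod (P.sitesPerDir k)) : Site P k)
      (fun ν => ((((s ν).val / b : ℕ)) : ZMod (P.sitesPerDir k))) ≤ 1 := by
  classical
  set s' : Fin P.d → ZMod n := s + Pi.single i (1 : ZMod n) with hs'
  rw [B3Taylor310LocalRemainder.tdist_eq_sum_natAbs]
  rw [Finset.sum_eq_single i]
  · have h1 := block_natAbs_valMinAbs_sub_le (N := P.sitesPerDir k) hn hb (s' i) (s i)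
    have h2 : (s' i - s i : ZMod n) = ((1 : ℤ) : ZMod n) := by simp [hs']
    have h3 : ((s' i - s i : ZMod n)).valMinAbs.natAbs ≤ 1 := by
      have := natAbs_valMinAbs_le_natAbs (s' i - s i) 1 h2.symm
      simpa using this
    have h4 : b * ((((s' i).val / b : ℕ) : ZMod (P.sitesPerDir k)) -
        (((s i).val / b : ℕ) : ZMod (P.sitesPerDir k))).valMinAbs.natAbs ≤ b * 1 := by omega
    exact Nat.le_of_mul_le_mul_left h4 hb
  · intro ν _ hν
    have : s' ν = s ν := by simp [hs', Pi.single_eq_of_ne hν]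
    simp [this]
  · intro h; exact absurd (Finset.mem_univ i) h

end Blocks

/-! ## §3 Cylinder measurability -/

/-- Restriction σ-algebras are monotone in the edge set: if `S ⊆ T` then every function of the links in `S` is
a function of the links in `T`. -/
theorem comap_restrict_mono {E G : Type*} [MeasurableSpace G] {S T : Set E} (hST : S ⊆ T) :
    MeasurableSpace.comap (fun V : E → G => S.restrict V) inferInstance ≤
      MeasurableSpace.comap (fun V : E → G => T.restrict V) inferInstance := by
  have h : Measurable[MeasurableSpace.comap (fun V : E → G => T.restrict V) inferInstance]
      (fun V : E → G => S.restrict V) := by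
    have e : (fun V : E → G => S.restrict V) =
        (fun W : T → G => fun x : S => W ⟨x.1, hST x.2⟩) ∘ (fun V : E → G => T.restrict V) := by
      funext V; rfl
    rw [e]
    exact (measurable_pi_lambda _ fun x => measurable_pi_apply _).comp (measurable_iff_comap_le.2 le_rfl)
  exact measurable_iff_comap_le.1 h

/-- LUSIN SEPARATION ⇒ DOOB–DYNKIN MEASURABILITY: on a standard Borel space `X`, if `Q : X → Y` is measurable into a
countably separated space and the composite `g ∘ Q` is (Borel) measurable, then `g ∘ Q` is measurable for the
σ-algebra `σ(Q) = comap Q` generated by `Q`.  (For a Borel `B`, the `Q`-images of `(g∘Q)⁻¹ B` and of its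
complement are disjoint analytic sets, hence Borel-separated; the separating set pulls back to `(g∘Q)⁻¹ B`.) -/
theorem measurable_comap_of_measurable_comp {X Y : Type*} [MeasurableSpace X] [StandardBorelSpace X]
    [mY : MeasurableSpace Y] [MeasurableSpace.CountablySeparated Y] {Q : X → Y} (hQ : Measurable Q) {g : Y → ℝ}
    (hg : Measurable (fun a => g (Q a))) :
    Measurable[MeasurableSpace.comap Q mY] (fun a => g (Q a)) := by
  intro B hB
  have hS : MeasurableSet ((fun a => g (Q a)) ⁻¹' B) := hg hB
  rcases exists_opensMeasurableSpace_of_countablySeparated Y with ⟨τ, _, _, _⟩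
  have h1 : MeasureTheory.AnalyticSet (Q '' ((fun a => g (Q a)) ⁻¹' B)) := hS.analyticSet_image hQ
  have h2 : MeasureTheory.AnalyticSet (Q '' ((fun a => g (Q a)) ⁻¹' B)ᶜ) := hS.compl.analyticSet_image hQ
  have hdisj : Disjoint (Q '' ((fun a => g (Q a)) ⁻¹' B)) (Q '' ((fun a => g (Q a)) ⁻¹' B)ᶜ) := by
    rw [Set.disjoint_left]
    rintro y ⟨a, ha, rfl⟩ ⟨b, hb, hab⟩
    apply hb
    simp only [Set.mem_preimage] at ha ⊢
    rw [hab]; exact ha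
  obtain ⟨A, hsub, hdis, hA⟩ := h1.measurablySeparable h2 hdisj
  refine ⟨A, hA, ?_⟩
  ext a
  refine ⟨fun ha => ?_, fun ha => hsub ⟨a, ha, rfl⟩⟩
  by_contra hna
  exact Set.disjoint_left.1 hdis ⟨a, hna, rfl⟩ ha

section Cylinder

variable {G : Type} [Group G] [TopologicalSpace G] [IsTopologicalGroup G] [MeasurableSpace G] [BorelSpace G]
  [SecondCountableTopology G]

/-- CYLINDER MEASURABILITY OF THE SINGLE-PLANE FIELD: `V ↦ plane q x (torusLift M V)` is measurable with respect
to the σ-algebra generated by the links in any edge set `E` containing the four edges of the plaquette of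
orientation `q` based at `x mod M`. -/
theorem measurable_comap_restrict_plane (r : LatticeRep G) (M : ℕ) (q : Fin 4 × Fin 4) (x : Fin 4 → ℤ)
    (E : Set (Edge 4 M))
    (h1 : (Literature.Probability.LatticeModels.Torus.proj M x, q.1) ∈ E)
    (h2 : (Literature.MathematicalPhysics.QuantumFieldTheory.Site.shift
      (Literature.Probability.LatticeModels.Torus.proj M x) q.1, q.2) ∈ E)
    (h3 : (Literature.MathematicalPhysics.QuantumFieldTheory.Site.shift
      (Literature.Probability.LatticeModels.Torus.proj M x) q.2, q.1) ∈ E)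
    (h4 : (Literature.Probability.LatticeModels.Torus.proj M x, q.2) ∈ E) :
    Measurable[MeasurableSpace.comap (fun V : GaugeConfig 4 M G => E.restrict V) inferInstance]
      (fun V => plane G r q x (torusLift M V)) := by
  let e1 : E := ⟨_, h1⟩
  let e2 : E := ⟨_, h2⟩
  let e3 : E := ⟨_, h3⟩
  let e4 : E := ⟨_, h4⟩
  let Φ : (E → G) → ℝ := fun W => (r.ρ (W e1 * W e2 * (W e3)⁻¹ * (W e4)⁻¹)).trace.re
  have m1 : Measurable (fun W : E → G => W e1) := measurable_pi_apply e1
  have m2 : Measurable (fun W : E → G => W e2) := measurable_pi_apply e2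
  have m3 : Measurable (fun W : E → G => W e3) := measurable_pi_apply e3
  have m4 : Measurable (fun W : E → G => W e4) := measurable_pi_apply e4
  have hprod : Measurable (fun W : E → G => W e1 * W e2 * (W e3)⁻¹ * (W e4)⁻¹) :=
    ((m1.mul m2).mul m3.inv).mul m4.inv
  borelize (Matrix (Fin r.N) (Fin r.N) ℂ)
  have htr : Measurable (fun A : Matrix (Fin r.N) (Fin r.N) ℂ => A.trace.re) :=
    (Complex.continuous_re.comp continuous_id.matrix_trace).measurable
  have hΦ : Measurable Φ := htr.comp (r.continuous.measurable.comp hprod)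
  have key : (fun V : GaugeConfig 4 M G => plane G r q x (torusLift M V)) =
      Φ ∘ (fun V : GaugeConfig 4 M G => E.restrict V) := by
    funext V
    simp only [Function.comp_apply, Φ, plane, Literature.MathematicalPhysics.QuantumLattice.plaquetteObs]
    rw [Summit.QuantumFields.YangMills.Cruxes.UV.TorusDictionary.plaquetteHolonomyZd_configShift_neg_zero,
      Literature.MathematicalPhysics.QuantumLattice.FreeEnergy.plaquetteHolonomyZd_torusLift]
    rfl
  rw [key]
  exact hΦ.comp (measurable_iff_comap_le.2 le_rfl)

end Cylinder

/-! ## §4 Two bookkeeping lemmas -/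

/-- A bounded measurable function on a finite measure space is integrable. -/
theorem integrable_of_abs_le {Ω : Type*} [MeasurableSpace Ω] (μ : Measure Ω) [IsFiniteMeasure μ]
    (f : Ω → ℝ) (A : ℝ) (hfm : Measurable f) (hfb : ∀ ω, |f ω| ≤ A) : Integrable f μ :=
  Integrable.mono' (integrable_const A) hfm.aestronglyMeasurable
    (Filter.Eventually.of_forall fun ω => by rw [Real.norm_eq_abs]; exact hfb ω)

/-- A product of factors bounded by `K` is bounded by `K ^ #S`. -/
theorem abs_prod_le_pow {Ω ι : Type*} (S : Finset ι) (f : ι → Ω → ℝ) (K : ℝ)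
    (hf : ∀ i ω, |f i ω| ≤ K) (ω : Ω) : |∏ i ∈ S, f i ω| ≤ K ^ S.card := by
  rw [Finset.abs_prod, ← Finset.prod_const]
  exact Finset.prod_le_prod (fun i _ => abs_nonneg _) fun i _ => hf i ω

end Summit.QuantumFields.YangMills.Theorems.BalabanMarkovExport.Toolkit
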